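import Literature.AlgebraicGeometry.Resolution.PointBlowupFlagDropMonomialStep
import HarnessLib

/-!
# Hauser–Perlega, Proposition 4 case (iii): the tangent flag `y + h(x)` at `a′` is the image of the tangent flag
# `y + x·h(x)` at `a` — `d_𝓖 = d_𝓕`, `n_𝓖 = n_𝓕 − 1`

H. Hauser, S. Perlega, *Resolving surface singularities in positive characteristic*, Publ. RIMS Kyoto Univ. **60**
(2024) 767–813 [cite: HauserPerlega2024], **Proposition 4** (p. 793), proof of **case (iii)** "`n_𝓖 ≥ 1` and
`G₁ = V(z + g(x,y), y + h(x))` with `ord h ≥ 1`" (p. 795 l. 20–31): "Since `n_𝓖 > 0` … `V(y) ⊆ E′_{a′}` holds. Hence,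
`t = 0` and `V(y) ⊆ E_a`. Set `y₀ = y + xh(x)` … `F′₁(x,y) = x^{−pᵉ}F₀(x,xy)`. Let `𝓕` be the flag `F₂ = V(z₀)`,
`F₁ = V(z₀,y₀)` at `a`. Notice that `n_𝓕 = ord h + 1 = n_𝓖 + 1`. Further, it is easy to verify that
`ord_ω(G) = ord_ω(F) − pᵉ` and `d^curv_𝓖 = d^curv_𝓕` hold. Hence, `d_𝓖 = d_𝓕`. Since `n_𝓖 < n_𝓕`, this proves
`inv^𝓖_{a′}(X′) < inv^𝓕_a(X)`."

## What is proved (sorry-free; any field `K`; NO new definition, NO named fact)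

* Section A — SERIES (two letters; the successor `T` of the monomial point step is GIVEN BY THE IDENTITY
  `x^q·T = S(x, xy)`): the exponent map `(A, i) ↦ (A + q − i, i)` between the supports of `T` and `S`
  (`coeff_eq_of_step`, `coeff_eq_of_step'`); for weights `ω′` on `T` and `ω` on `S` with `ω(x) = ω′(x)`, `ω(y) = ω′(y) + ω′(x)`
  — `(1, n)` and `(1, n + 1)` in case (iii), `(n, 1)` and `(n, n + 1)` in case (iv) — **`ord_ω(S) = ord_{ω′}(T) + q·w_x`**
  (`wOrder_eq_wOrder_add_of_step`: "`ord_ω(G) = ord_ω(F) − pᵉ`"), the initial forms correspond with equal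
  `y`-exponents, so **`d^curv` is the same** (`ordAlong_initialPart_eq_of_step`), and the `d_𝓕`-shaped numeral is the
  same (`dFlagShape_eq_of_step`); the identity for the cleaned shifted expansions along the flags `y + φ(x)` at `a′` and
  `y + x·φ(x)` at `a` (`X_pow_mul_cleanShift_eq_step`).
* Section B — TYPED BRIDGES to the atlas step `PointBlowup.step q x 0 s` (chart of the exceptional letter `x`, point
  `t = 0`): `↑(deletePthPowers q P) = cleanSeries q ↑P` (`coe_deletePthPowers`), `x^q·↑(chartTransform q x F) = ↑F(x,xy)`
  for `q ≤ ord F` (`X_pow_mul_coe_chartTransform`), hence `x^q·↑((step q x 0 s).F) = clean_q(↑s.F)(x, xy)`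
  (`X_pow_mul_coe_step_zero`).
* Section C — TYPED case (iii) (`PointBlowupFlagInvariant`): along `step q x 0 s` with `q ≤ ord s.F`,
  `dCurv q ⟨y,x,h⟩ n F′ = dCurv q ⟨y,x,X·h⟩ (n+1) s.F`, `dFlag` likewise (`dCurv_step_eq`, `dFlag_step_eq`), and
  **`invCaseTangent q ⟨y,x,h⟩ n F′ < invCaseTangent q ⟨y,x,X·h⟩ (n+1) s.F`** (`invCaseTangent_step_lt`) — "`d_𝓖 = d_𝓕`.
  Since `n_𝓖 < n_𝓕`, this proves `inv^𝓖 < inv^𝓕`"; with the flag-type bookkeeping `IsCaseTangent E′ n → IsCaseTangent E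
  (n + 1)` when `y ∈ E` and `x ∈ E` (`isCaseTangent_mul_X`).

## What is NOT proved here

Cases (ii), (iv) (seat res-L1-w43-stub-2); the maximality clause of Proposition 4 (that a maximizing `𝓖` at `a′` is of
one of the four shapes — Lemma 1); the exceptional-letter bookkeeping `excLetters (step …)` in general.

Provenance: seat res-D-pv-058 acting as res-L1-w43-stub-6 (cell res-hironaka, chain W4.3), 2026-08-27; a Literature
transcription of a PRINTED, refereed proposition in the tree's polynomial/power-series model — not a statement about
any manuscript under adjudication.
-/

noncomputable section

open MvPolynomial Finset
open scoped BigOperators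

namespace Literature.AlgebraicGeometry.Resolution

open Literature.AlgebraicGeometry.Resolution.Hauser2010
open Literature.AlgebraicGeometry.Resolution.PointBlowup
open Literature.AlgebraicGeometry.Resolution.HauserWagner2014

namespace HauserPerlega2024

/-! ## A. Series: weighted orders and initial forms across the monomial step `x^q·T = S(x, xy)` -/

section SeriesStep

variable {σ : Type*} {K : Type*} [Field K]

/-- the exponent `x^a y^b` evaluated at `x`. [folklore] -/
private theorem ssa_l {x y : σ} (hxy : x ≠ y) (a b : ℕ) : (Finsupp.single x a + Finsupp.single y b) x = a := by
  classical
  rw [Finsupp.add_apply, Finsupp.single_eq_same, Finsupp.single_apply, if_neg (Ne.symm hxy), add_zero]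

/-- the exponent `x^a y^b` evaluated at `y`. [folklore] -/
private theorem ssa_r {x y : σ} (hxy : x ≠ y) (a b : ℕ) : (Finsupp.single x a + Finsupp.single y b) y = b := by
  classical
  rw [Finsupp.add_apply, Finsupp.single_eq_same, Finsupp.single_apply, if_neg hxy, zero_add]

/-- two letters: an exponent is determined by its two entries. [folklore] -/
private theorem fs_eq2 {x y : σ} (hσ : ∀ l, l = x ∨ l = y) {d d' : σ →₀ ℕ} (hx : d x = d' x)
    (hy : d y = d' y) : d = d' := by
  ext l
  rcases hσ l with rfl | rfl
  · exact hx
  · exact hy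

/-- two letters: every exponent is `x^{d_x} y^{d_y}`. [folklore] -/
private theorem eq_ssa2 {x y : σ} (hxy : x ≠ y) (hσ : ∀ l, l = x ∨ l = y) (d : σ →₀ ℕ) :
    d = Finsupp.single x (d x) + Finsupp.single y (d y) :=
  fs_eq2 hσ (ssa_l hxy _ _).symm (ssa_r hxy _ _).symm

/-- two letters: a sum over all letters has two terms. [folklore] -/
private theorem sum_two {M : Type*} [AddCommMonoid M] [Fintype σ] {x y : σ} (hxy : x ≠ y)
    (hσ : ∀ l, l = x ∨ l = y) (f : σ → M) : ∑ l, f l = f x + f y := by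
  classical
  have huniv : (Finset.univ : Finset σ) = {x, y} := by
    ext l
    simp only [Finset.mem_univ, Finset.mem_insert, Finset.mem_singleton, true_iff]
    exact hσ l
  rw [huniv, Finset.sum_pair hxy]

/-- two letters: the weight of an exponent. [folklore] -/
private theorem weight_two [Fintype σ] {x y : σ} (hxy : x ≠ y) (hσ : ∀ l, l = x ∨ l = y) (w : σ → ℕ)
    (m : σ →₀ ℕ) : Finsupp.weight w m = m x * w x + m y * w y := by
  rw [Finsupp.weight_apply, Finsupp.sum_fintype _ _ (fun i => by simp), sum_two hxy hσ]
  simp only [smul_eq_mul]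

open scoped Classical in
/-- unfolding the cleaning. [folklore] -/
private theorem coeff_clean (q : ℕ) (H : MvPowerSeries σ K) (d : σ →₀ ℕ) :
    MvPowerSeries.coeff d (cleanSeries q H) = if ∀ i, q ∣ d i then 0 else MvPowerSeries.coeff d H := rfl

variable [Fintype σ] [DecidableEq σ]

/-- **the exponent map of the step, from `T` to `S`**: under `x^q·T = S(x,xy)`, a monomial `x^A yⁱ` of `T` is the
monomial `x^{A+q−i} yⁱ` of `S` (and `i ≤ A + q`). [cite: HauserPerlega2024, §2 p. 774 l. 9–13 (F′ = x^{−pᵉ}·φ(F))] -/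
theorem coeff_eq_of_step (q : ℕ) (x y : σ) (hxy : x ≠ y) (hσ : ∀ l, l = x ∨ l = y) (S T : MvPowerSeries σ K)
    (hT : (MvPowerSeries.X x : MvPowerSeries σ K) ^ q * T = MvPowerSeries.subst (fun l => if l = y then (MvPowerSeries.X x : MvPowerSeries σ K) * MvPowerSeries.X y
        else MvPowerSeries.X l) S) (m : σ →₀ ℕ) :
    MvPowerSeries.coeff m T = if m y ≤ m x + q then
      MvPowerSeries.coeff (Finsupp.single x (m x + q - m y) + Finsupp.single y (m y)) S else 0 := by
  classical
  have h1 : MvPowerSeries.coeff m T =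
      MvPowerSeries.coeff (m + Finsupp.single x q) ((MvPowerSeries.X x : MvPowerSeries σ K) ^ q * T) := by
    rw [MvPowerSeries.X_pow_eq, MvPowerSeries.coeff_monomial_mul, if_pos le_add_self, one_mul, add_tsub_cancel_right]
  have hmx : (m + Finsupp.single x q) x = m x + q := by rw [Finsupp.add_apply, Finsupp.single_eq_same]
  have hmy : (m + Finsupp.single x q) y = m y := by
    rw [Finsupp.add_apply, Finsupp.single_apply, if_neg hxy, add_zero]
  rw [h1, hT, coeff_subst_step x y hxy hσ, hmx, hmy]

/-- **the exponent map of the step, from `S` to `T`**: under `x^q·T = S(x,xy)`, a monomial `x^a yⁱ` of `S` has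
`q ≤ a + i` and is the monomial `x^{a+i−q} yⁱ` of `T`. [cite: HauserPerlega2024, §2 p. 774 l. 9–13] -/
theorem coeff_eq_of_step' (q : ℕ) (x y : σ) (hxy : x ≠ y) (hσ : ∀ l, l = x ∨ l = y) (S T : MvPowerSeries σ K)
    (hT : (MvPowerSeries.X x : MvPowerSeries σ K) ^ q * T = MvPowerSeries.subst (fun l => if l = y then (MvPowerSeries.X x : MvPowerSeries σ K) * MvPowerSeries.X y
        else MvPowerSeries.X l) S) (m : σ →₀ ℕ)
    (hm : MvPowerSeries.coeff m S ≠ 0) :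
    q ≤ m x + m y ∧
      MvPowerSeries.coeff (Finsupp.single x (m x + m y - q) + Finsupp.single y (m y)) T = MvPowerSeries.coeff m S := by
  classical
  set M : σ →₀ ℕ := Finsupp.single x (m x + m y) + Finsupp.single y (m y) with hM
  have h1 : MvPowerSeries.coeff M (MvPowerSeries.subst (fun l => if l = y then (MvPowerSeries.X x : MvPowerSeries σ K) * MvPowerSeries.X y
        else MvPowerSeries.X l) S) = MvPowerSeries.coeff m S := by
    rw [coeff_subst_step x y hxy hσ, hM, ssa_l hxy, ssa_r hxy, if_pos (Nat.le_add_left _ _), Nat.add_sub_cancel,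
      ← eq_ssa2 hxy hσ m]
  rw [← hT, MvPowerSeries.X_pow_eq, MvPowerSeries.coeff_monomial_mul] at h1
  by_cases hle : Finsupp.single x q ≤ M
  · rw [if_pos hle, one_mul] at h1
    have hq : q ≤ m x + m y := by have := hle x; rwa [Finsupp.single_eq_same, hM, ssa_l hxy] at this
    refine ⟨hq, ?_⟩
    have hsub : M - Finsupp.single x q = Finsupp.single x (m x + m y - q) + Finsupp.single y (m y) := by
      apply fs_eq2 hσ
      · rw [Finsupp.tsub_apply, hM, ssa_l hxy, ssa_l hxy, Finsupp.single_eq_same]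
      · rw [Finsupp.tsub_apply, hM, ssa_r hxy, ssa_r hxy, Finsupp.single_apply, if_neg hxy, Nat.sub_zero]
    rw [← hsub]
    exact h1
  · rw [if_neg hle] at h1
    exact absurd h1.symm hm

/-- **"`ord_ω(G) = ord_ω(F) − pᵉ`"**: under `x^q·T = S(x,xy)`, for weights `ω′` on `T` and `ω` on `S` with
`ω(x) = ω′(x)` and `ω(y) = ω′(y) + ω′(x)` — `(1, n_𝓖)` at `a′` and `(1, n_𝓖 + 1) = (1, n_𝓕)` at `a` in case (iii), `(n, 1)`
and `(n, n + 1)` in case (iv) — `ord_ω(S) = ord_{ω′}(T) + q·ω′(x)` (in `ℕ∞`).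
[cite: HauserPerlega2024, Prop. 4 proof case (iii) p. 795 l. 27–29] -/
theorem wOrder_eq_wOrder_add_of_step (q : ℕ) (x y : σ) (hxy : x ≠ y) (hσ : ∀ l, l = x ∨ l = y)
    (S T : MvPowerSeries σ K)
    (hT : (MvPowerSeries.X x : MvPowerSeries σ K) ^ q * T = MvPowerSeries.subst (fun l => if l = y then (MvPowerSeries.X x : MvPowerSeries σ K) * MvPowerSeries.X y
        else MvPowerSeries.X l) S) (w w' : σ → ℕ)
    (hwx : w x = w' x) (hwy : w y = w' y + w' x) :
    wOrder w S = wOrder w' T + ((q * w' x : ℕ) : ℕ∞) := by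
  classical
  unfold wOrder
  have hwS : ∀ m : σ →₀ ℕ, Finsupp.weight w m = m x * w' x + m y * (w' y + w' x) := fun m => by
    rw [weight_two hxy hσ w m, hwx, hwy]
  have hwT : ∀ m : σ →₀ ℕ, Finsupp.weight w' m = m x * w' x + m y * w' y := weight_two hxy hσ w'
  apply le_antisymm
  · -- `≤`: a monomial of `T` realising its order gives a monomial of `S`
    by_cases hT0 : T = 0
    · rw [hT0, MvPowerSeries.weightedOrder_zero, top_add]; exact le_top
    · obtain ⟨m, hm, hwm⟩ := MvPowerSeries.exists_coeff_ne_zero_and_weightedOrder _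
        ((MvPowerSeries.ne_zero_iff_weightedOrder_finite _).mp hT0)
      have h1 := coeff_eq_of_step q x y hxy hσ S T hT m
      by_cases hle : m y ≤ m x + q
      · rw [if_pos hle] at h1
        have hne : MvPowerSeries.coeff (Finsupp.single x (m x + q - m y) + Finsupp.single y (m y)) S ≠ 0 := by
          rw [← h1]; exact hm
        refine le_trans (MvPowerSeries.weightedOrder_le _ hne) ?_
        rw [← hwm, hwS, hwT, ssa_l hxy, ssa_r hxy, ← Nat.cast_add, Nat.cast_le]
        have : (m x + q - m y) * w' x + m y * (w' y + w' x) = m x * w' x + m y * w' y + q * w' x := by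
          zify [hle]
          ring
        omega
      · rw [if_neg hle] at h1
        exact absurd h1 hm
  · -- `≥`: every monomial of `S` comes from a monomial of `T`
    refine MvPowerSeries.le_weightedOrder _ fun m hlt => ?_
    by_contra hm
    obtain ⟨hq, hcoef⟩ := coeff_eq_of_step' q x y hxy hσ S T hT m hm
    have hne : MvPowerSeries.coeff (Finsupp.single x (m x + m y - q) + Finsupp.single y (m y)) T ≠ 0 := by
      rw [hcoef]; exact hm
    have h2 := MvPowerSeries.weightedOrder_le w' hne
    rw [hwT, ssa_l hxy, ssa_r hxy] at h2
    rw [hwS] at hlt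
    have h3 : MvPowerSeries.weightedOrder w' T + ((q * w' x : ℕ) : ℕ∞) ≤
        (((m x + m y - q) * w' x + m y * w' y : ℕ) : ℕ∞) + ((q * w' x : ℕ) : ℕ∞) := add_le_add h2 le_rfl
    rw [← Nat.cast_add] at h3
    have h4 : (m x + m y - q) * w' x + m y * w' y + q * w' x = m x * w' x + m y * (w' y + w' x) := by
      zify [hq]
      ring
    rw [h4] at h3
    exact absurd (lt_of_le_of_lt h3 hlt) (lt_irrefl _)

/-- **"`d^curv_𝓖 = d^curv_𝓕`"**: under `x^q·T = S(x,xy)` the weighted initial forms (weights as above) correspond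
monomial by monomial with the same `y`-exponents, so their orders along `V(y)` agree.
[cite: HauserPerlega2024, Prop. 4 proof case (iii) p. 795 l. 27–30] -/
theorem ordAlong_initialPart_eq_of_step (q : ℕ) (x y : σ) (hxy : x ≠ y) (hσ : ∀ l, l = x ∨ l = y)
    (S T : MvPowerSeries σ K)
    (hT : (MvPowerSeries.X x : MvPowerSeries σ K) ^ q * T = MvPowerSeries.subst (fun l => if l = y then (MvPowerSeries.X x : MvPowerSeries σ K) * MvPowerSeries.X y
        else MvPowerSeries.X l) S) (w w' : σ → ℕ)
    (hwx : w x = w' x) (hwy : w y = w' y + w' x) :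
    ordAlong y (initialPart w S) = ordAlong y (initialPart w' T) := by
  classical
  have hwS : ∀ m : σ →₀ ℕ, Finsupp.weight w m = m x * w' x + m y * (w' y + w' x) := fun m => by
    rw [weight_two hxy hσ w m, hwx, hwy]
  have hwT : ∀ m : σ →₀ ℕ, Finsupp.weight w' m = m x * w' x + m y * w' y := weight_two hxy hσ w'
  have hord := wOrder_eq_wOrder_add_of_step q x y hxy hσ S T hT w w' hwx hwy
  -- unfold `initialPart` / `ordAlong` through their coefficients
  have hiS : ∀ d : σ →₀ ℕ, initialPart w S d =
      if ((Finsupp.weight w d : ℕ) : ℕ∞) = wOrder w S then S d else 0 := fun d => rfl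
  have hiT : ∀ d : σ →₀ ℕ, initialPart w' T d =
      if ((Finsupp.weight w' d : ℕ) : ℕ∞) = wOrder w' T then T d else 0 := fun d => rfl
  unfold ordAlong
  apply le_antisymm
  · refine le_iInf₂ fun d' hd' => ?_
    rw [hiT] at hd'
    by_cases hc : ((Finsupp.weight w' d' : ℕ) : ℕ∞) = wOrder w' T
    · rw [if_pos hc] at hd'
      have h1 := coeff_eq_of_step q x y hxy hσ S T hT d'
      rw [MvPowerSeries.coeff_apply] at h1
      by_cases hle : d' y ≤ d' x + q
      · rw [if_pos hle] at h1
        set d : σ →₀ ℕ := Finsupp.single x (d' x + q - d' y) + Finsupp.single y (d' y) with hd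
        have hSd : S d ≠ 0 := by rw [hd, ← MvPowerSeries.coeff_apply S, ← h1]; exact hd'
        have hwd : ((Finsupp.weight w d : ℕ) : ℕ∞) = wOrder w S := by
          rw [hord, ← hc, hwS, hwT, hd, ssa_l hxy, ssa_r hxy, ← Nat.cast_add]
          congr 1
          zify [hle]
          ring
        have hin : initialPart w S d ≠ 0 := by
          rw [hiS, if_pos hwd]; exact hSd
        calc ⨅ (e : σ →₀ ℕ) (_ : initialPart w S e ≠ 0), ((e y : ℕ) : ℕ∞)
            ≤ ((d y : ℕ) : ℕ∞) := iInf₂_le d hin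
          _ = ((d' y : ℕ) : ℕ∞) := by rw [hd, ssa_r hxy]
      · rw [if_neg hle] at h1
        exact absurd h1 hd'
    · rw [if_neg hc] at hd'
      exact absurd rfl hd'
  · refine le_iInf₂ fun d hd => ?_
    rw [hiS] at hd
    by_cases hc : ((Finsupp.weight w d : ℕ) : ℕ∞) = wOrder w S
    · rw [if_pos hc] at hd
      have hSd : MvPowerSeries.coeff d S ≠ 0 := by rw [MvPowerSeries.coeff_apply]; exact hd
      obtain ⟨hq, hcoef⟩ := coeff_eq_of_step' q x y hxy hσ S T hT d hSd
      set d' : σ →₀ ℕ := Finsupp.single x (d x + d y - q) + Finsupp.single y (d y) with hd'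
      have hTd : T d' ≠ 0 := by rw [← MvPowerSeries.coeff_apply T, hcoef]; exact hSd
      have hT0 : T ≠ 0 := fun h0 => hTd (by rw [h0]; rfl)
      have hwd : ((Finsupp.weight w' d' : ℕ) : ℕ∞) = wOrder w' T := by
        have hfin : wOrder w' T ≠ ⊤ := by
          unfold wOrder; rw [Ne, MvPowerSeries.weightedOrder_eq_top_iff]; exact hT0
        obtain ⟨o, ho⟩ := ENat.ne_top_iff_exists.mp hfin
        rw [← ho] at hord ⊢
        have h6 : d x * w' x + d y * (w' y + w' x) = o + q * w' x := by
          have h7 := hc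
          rw [hwS, hord, ← Nat.cast_add, Nat.cast_inj] at h7
          exact h7
        rw [hwT, hd', ssa_l hxy, ssa_r hxy, Nat.cast_inj]
        zify [hq] at h6 ⊢
        linear_combination h6
      have hin : initialPart w' T d' ≠ 0 := by
        rw [hiT, if_pos hwd]; exact hTd
      calc ⨅ (e : σ →₀ ℕ) (_ : initialPart w' T e ≠ 0), ((e y : ℕ) : ℕ∞)
          ≤ ((d' y : ℕ) : ℕ∞) := iInf₂_le d' hin
        _ = ((d y : ℕ) : ℕ∞) := by rw [hd', ssa_r hxy]
    · rw [if_neg hc] at hd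
      exact absurd rfl hd

/-- **"Hence `d_𝓖 = d_𝓕`"**: the `d_𝓕`-shaped numeral "`0` if `0 < d^curv < pᵉ` and `pᵉ ∣ ord_ω`, `d^curv` otherwise"
takes the same value on `T` (weights `ω′`) and on `S` (weights `ω`), since `d^curv` agrees and the weighted orders
differ by `q·ω′(x)`. [cite: HauserPerlega2024, Prop. 4 proof case (iii) p. 795 l. 29–30; §5 p. 784 (d_𝓕)] -/
theorem dFlagShape_eq_of_step (q : ℕ) (x y : σ) (hxy : x ≠ y) (hσ : ∀ l, l = x ∨ l = y)
    (S T : MvPowerSeries σ K)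
    (hT : (MvPowerSeries.X x : MvPowerSeries σ K) ^ q * T = MvPowerSeries.subst (fun l => if l = y then (MvPowerSeries.X x : MvPowerSeries σ K) * MvPowerSeries.X y
        else MvPowerSeries.X l) S) (w w' : σ → ℕ)
    (hwx : w x = w' x) (hwy : w y = w' y + w' x) :
    (if 0 < (ordAlong y (initialPart w' T)).toNat ∧ (ordAlong y (initialPart w' T)).toNat < q ∧
          q ∣ (wOrder w' T).toNat
      then 0 else (ordAlong y (initialPart w' T)).toNat) =
    (if 0 < (ordAlong y (initialPart w S)).toNat ∧ (ordAlong y (initialPart w S)).toNat < q ∧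
          q ∣ (wOrder w S).toNat
      then 0 else (ordAlong y (initialPart w S)).toNat) := by
  have hdc := ordAlong_initialPart_eq_of_step q x y hxy hσ S T hT w w' hwx hwy
  have hord := wOrder_eq_wOrder_add_of_step q x y hxy hσ S T hT w w' hwx hwy
  rw [hdc]
  have hdvd : q ∣ (wOrder w' T).toNat ↔ q ∣ (wOrder w S).toNat := by
    rw [hord]
    by_cases hfin : wOrder w' T = ⊤
    · rw [hfin, top_add]
    · obtain ⟨o, ho⟩ := ENat.ne_top_iff_exists.mp hfin
      rw [← ho, ← Nat.cast_add, ENat.toNat_coe, ENat.toNat_coe]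
      exact (Nat.dvd_add_left (dvd_mul_right q (w' x))).symm
  simp only [hdvd]

omit [Fintype σ] in
/-- cleaning commutes with multiplication by `x^q` (the shift `a ↦ a + q` preserves `q ∣ a`). [folklore] -/
private theorem cleanSeries_X_pow_mul' (q : ℕ) (x y : σ) (hxy : x ≠ y) (hσ : ∀ l, l = x ∨ l = y)
    (T : MvPowerSeries σ K) :
    cleanSeries q ((MvPowerSeries.X x : MvPowerSeries σ K) ^ q * T) =
      (MvPowerSeries.X x : MvPowerSeries σ K) ^ q * cleanSeries q T := by
  classical
  have fdt : ∀ d : σ →₀ ℕ, (∀ l, q ∣ d l) ↔ q ∣ d x ∧ q ∣ d y := fun d =>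
    ⟨fun h => ⟨h x, h y⟩, fun h l => by rcases hσ l with rfl | rfl; exacts [h.1, h.2]⟩
  ext m
  rw [coeff_clean, MvPowerSeries.X_pow_eq, MvPowerSeries.coeff_monomial_mul, MvPowerSeries.coeff_monomial_mul,
    coeff_clean]
  simp only [fdt]
  by_cases hle : Finsupp.single x q ≤ m
  · rw [if_pos hle, if_pos hle, one_mul, one_mul]
    have hmx : q ≤ m x := by have := hle x; rwa [Finsupp.single_eq_same] at this
    have h1 : (m - Finsupp.single x q) x = m x - q := by rw [Finsupp.tsub_apply, Finsupp.single_eq_same]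
    have h2 : (m - Finsupp.single x q) y = m y := by
      rw [Finsupp.tsub_apply, Finsupp.single_apply, if_neg hxy, Nat.sub_zero]
    rw [h1, h2]
    have hiff : (q ∣ m x ∧ q ∣ m y) ↔ (q ∣ m x - q ∧ q ∣ m y) := by
      constructor
      · rintro ⟨h3, h4⟩; exact ⟨Nat.dvd_sub h3 dvd_rfl, h4⟩
      · rintro ⟨h3, h4⟩
        refine ⟨?_, h4⟩
        have := Nat.dvd_add h3 (dvd_refl q)
        rwa [Nat.sub_add_cancel hmx] at this
    by_cases hd : q ∣ m x ∧ q ∣ m y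
    · rw [if_pos hd, if_pos (hiff.mp hd)]
    · rw [if_neg hd, if_neg (fun h => hd (hiff.mpr h))]
  · rw [if_neg hle, if_neg hle]
    split_ifs <;> rfl

/-- **The step along corresponding flags**: if `x^q·H′ = H(x,xy)` then for every shift `φ`,
`x^q · clean_q(H′(x, y + φ(x))) = (clean_q(H(x, y + x·φ(x))))(x, xy)` — the cleaned expansion along the flag `y + h(x)`
at `a′` is the monomial step of the cleaned expansion along `y + x·h(x)` at `a` ("`F′₁(x,y) = x^{−pᵉ}F₀(x,xy)`").
[cite: HauserPerlega2024, Prop. 4 proof case (iii) p. 795 l. 22–26; case (i) p. 794 l. 22–26] -/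
theorem X_pow_mul_cleanShift_eq_step (q : ℕ) (x y : σ) (hxy : x ≠ y) (hσ : ∀ l, l = x ∨ l = y)
    (H H' : MvPowerSeries σ K)
    (hH' : (MvPowerSeries.X x : MvPowerSeries σ K) ^ q * H' = MvPowerSeries.subst (fun l => if l = y then (MvPowerSeries.X x : MvPowerSeries σ K) * MvPowerSeries.X y
        else MvPowerSeries.X l) H)
    (φ : PowerSeries K) (hφ : PowerSeries.constantCoeff φ = 0) :
    (MvPowerSeries.X x : MvPowerSeries σ K) ^ q * cleanSeries q (MvPowerSeries.subst (fun l => if l = y then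
        (MvPowerSeries.X y : MvPowerSeries σ K) + PowerSeries.subst (MvPowerSeries.X x : MvPowerSeries σ K) φ
        else MvPowerSeries.X l) H') =
      MvPowerSeries.subst (fun l => if l = y then (MvPowerSeries.X x : MvPowerSeries σ K) * MvPowerSeries.X y
        else MvPowerSeries.X l) (cleanSeries q (MvPowerSeries.subst (fun l => if l = y then
        (MvPowerSeries.X y : MvPowerSeries σ K) + PowerSeries.subst (MvPowerSeries.X x : MvPowerSeries σ K) (PowerSeries.X * φ)
        else MvPowerSeries.X l) H)) := by
  have hsh := hasSubst_shift x y φ hφ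
  rw [← cleanSeries_X_pow_mul' q x y hxy hσ, ← cleanSeries_subst_step q x y hxy hσ,
    ← subst_shift_subst_step x y hxy φ hφ H, ← hH', MvPowerSeries.subst_mul hsh, MvPowerSeries.subst_pow hsh,
    MvPowerSeries.subst_X hsh, if_neg hxy]

/-- the same when the successor is computed from the CLEANED germ (`x^q·H′ = (clean_q H)(x,xy)`, as the atlas step
does): cleaning commutes with the substitution (`cleanSeries_subst_cleanSeries`). [cite: HauserPerlega2024, Prop. 4 proof case (iii) p. 795 l. 22–26] -/
theorem X_pow_mul_cleanShift_eq_step_of_clean (p : ℕ) [Fact p.Prime] [CharP K p] {e : ℕ} (x y : σ) (hxy : x ≠ y)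
    (hσ : ∀ l, l = x ∨ l = y) (H H' : MvPowerSeries σ K)
    (hH' : (MvPowerSeries.X x : MvPowerSeries σ K) ^ p ^ e * H' =
      MvPowerSeries.subst (fun l => if l = y then (MvPowerSeries.X x : MvPowerSeries σ K) * MvPowerSeries.X y
        else MvPowerSeries.X l) (cleanSeries (p ^ e) H))
    (φ : PowerSeries K) (hφ : PowerSeries.constantCoeff φ = 0) :
    (MvPowerSeries.X x : MvPowerSeries σ K) ^ p ^ e * cleanSeries (p ^ e) (MvPowerSeries.subst (fun l => if l = y then
        (MvPowerSeries.X y : MvPowerSeries σ K) + PowerSeries.subst (MvPowerSeries.X x : MvPowerSeries σ K) φ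
        else MvPowerSeries.X l) H') =
      MvPowerSeries.subst (fun l => if l = y then (MvPowerSeries.X x : MvPowerSeries σ K) * MvPowerSeries.X y
        else MvPowerSeries.X l) (cleanSeries (p ^ e) (MvPowerSeries.subst (fun l => if l = y then
        (MvPowerSeries.X y : MvPowerSeries σ K) + PowerSeries.subst (MvPowerSeries.X x : MvPowerSeries σ K) (PowerSeries.X * φ)
        else MvPowerSeries.X l) H)) := by
  have hXφ : PowerSeries.constantCoeff (PowerSeries.X * φ) = 0 := by
    rw [map_mul, PowerSeries.constantCoeff_X, zero_mul]
  rw [X_pow_mul_cleanShift_eq_step (p ^ e) x y hxy hσ (cleanSeries (p ^ e) H) H' hH' φ hφ,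
    cleanSeries_subst_cleanSeries p e (hasSubst_shift x y (PowerSeries.X * φ) hXφ)]

end SeriesStep

/-! ## B. Typed bridges: the atlas step `PointBlowup.step q x 0 s` as a series identity -/

section Bridges

variable {σ : Type*} [Fintype σ] [DecidableEq σ] {K : Type*} [Field K]

omit [Fintype σ] in
/-- the atlas's deletion of `q`-th power monomials is the cleaning of the series. [cite: HauserPerlega2024, §2 p. 774 (clean expansion)] -/
theorem coe_deletePthPowers (q : ℕ) (P : MvPolynomial σ K) :
    ((deletePthPowers q P : MvPolynomial σ K) : MvPowerSeries σ K) = cleanSeries q (P : MvPowerSeries σ K) := by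
  classical
  ext n
  rw [MvPolynomial.coeff_coe, coeff_deletePthPowers, coeff_clean, MvPolynomial.coeff_coe]
  by_cases h : IsPthPowerExponent q n
  · rw [if_pos h, if_pos ((isPthPowerExponent_iff q n).mp h)]
  · rw [if_neg h, if_neg (fun h' => h ((isPthPowerExponent_iff q n).mpr h'))]

/-- two letters: the chart exponent of the `x`-chart, `(d_x, d_y) ↦ (d_x + d_y − q, d_y)`. [cite: HauserPerlega2024, §2 p. 774 l. 9–13] -/
private theorem chartExponent_apply_two (q : ℕ) {x y : σ} (hxy : x ≠ y) (hσ : ∀ l, l = x ∨ l = y) (d : σ →₀ ℕ) :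
    chartExponent q x d x = d x + d y - q ∧ chartExponent q x d y = d y := by
  unfold chartExponent
  rw [Finsupp.update_apply, Finsupp.update_apply, if_pos rfl, if_neg (Ne.symm hxy), Finsupp.degree_eq_sum,
    sum_two hxy hσ]
  exact ⟨rfl, rfl⟩

/-- **the coefficients of the chart transform** (two letters, chart of `x`, all monomials of `F` of degree `≥ q`):
`[x^{n_x} y^{n_y}] F^∨ = [x^{n_x + q − n_y} y^{n_y}] F` if `n_y ≤ n_x + q`, else `0`.
[cite: HauserPerlega2024, §2 p. 774 l. 9–13 (F′ = x^{−pᵉ}·φ(F))] -/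
theorem coeff_coe_chartTransform (q : ℕ) (x y : σ) (hxy : x ≠ y) (hσ : ∀ l, l = x ∨ l = y) (F : MvPolynomial σ K)
    (hF : ∀ d ∈ F.support, q ≤ d.degree) (n : σ →₀ ℕ) :
    MvPowerSeries.coeff n (chartTransform q x F : MvPowerSeries σ K) =
      if n y ≤ n x + q then MvPolynomial.coeff (Finsupp.single x (n x + q - n y) + Finsupp.single y (n y)) F else 0 := by
  classical
  have hdeg : ∀ d : σ →₀ ℕ, d.degree = d x + d y := fun d => by rw [Finsupp.degree_eq_sum, sum_two hxy hσ]
  rw [MvPolynomial.coeff_coe]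
  unfold chartTransform
  rw [coeff_sum]
  simp_rw [coeff_monomial]
  by_cases hle : n y ≤ n x + q
  · rw [if_pos hle]
    set d₀ : σ →₀ ℕ := Finsupp.single x (n x + q - n y) + Finsupp.single y (n y) with hd₀
    have hχ₀ : chartExponent q x d₀ = n := by
      obtain ⟨h1, h2⟩ := chartExponent_apply_two q hxy hσ d₀
      apply fs_eq2 hσ
      · rw [h1, hd₀, ssa_l hxy, ssa_r hxy]; omega
      · rw [h2, hd₀, ssa_r hxy]
    rw [Finset.sum_eq_single d₀]
    · rw [if_pos hχ₀]
    · intro d hd hne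
      rw [if_neg]
      intro hχ
      apply hne
      obtain ⟨h1, h2⟩ := chartExponent_apply_two q hxy hσ d
      have hq := hF d hd
      rw [hdeg] at hq
      rw [hχ] at h1 h2
      apply fs_eq2 hσ
      · rw [hd₀, ssa_l hxy]; omega
      · rw [hd₀, ssa_r hxy]; exact h2.symm
    · intro hd₀s
      rw [if_pos hχ₀]
      exact MvPolynomial.notMem_support_iff.mp hd₀s
  · rw [if_neg hle]
    refine Finset.sum_eq_zero fun d hd => ?_
    rw [if_neg]
    intro hχ
    obtain ⟨h1, h2⟩ := chartExponent_apply_two q hxy hσ d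
    have hq := hF d hd
    rw [hdeg] at hq
    rw [hχ] at h1 h2
    omega

/-- **`x^q·F^∨ = F(x, xy)`** for the chart transform of the `x`-chart (all monomials of `F` of degree `≥ q`).
[cite: HauserPerlega2024, §2 p. 774 l. 9–13] -/
theorem X_pow_mul_coe_chartTransform (q : ℕ) (x y : σ) (hxy : x ≠ y) (hσ : ∀ l, l = x ∨ l = y)
    (F : MvPolynomial σ K) (hF : ∀ d ∈ F.support, q ≤ d.degree) :
    (MvPowerSeries.X x : MvPowerSeries σ K) ^ q * (chartTransform q x F : MvPowerSeries σ K) =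
      MvPowerSeries.subst (fun l => if l = y then (MvPowerSeries.X x : MvPowerSeries σ K) * MvPowerSeries.X y
        else MvPowerSeries.X l) (F : MvPowerSeries σ K) := by
  classical
  have hdeg : ∀ d : σ →₀ ℕ, d.degree = d x + d y := fun d => by rw [Finsupp.degree_eq_sum, sum_two hxy hσ]
  ext m
  rw [MvPowerSeries.X_pow_eq, MvPowerSeries.coeff_monomial_mul, coeff_subst_step x y hxy hσ]
  by_cases hq : Finsupp.single x q ≤ m
  · have hmx : q ≤ m x := by have := hq x; rwa [Finsupp.single_eq_same] at this
    have h1 : (m - Finsupp.single x q) x = m x - q := by rw [Finsupp.tsub_apply, Finsupp.single_eq_same]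
    have h2 : (m - Finsupp.single x q) y = m y := by
      rw [Finsupp.tsub_apply, Finsupp.single_apply, if_neg hxy, Nat.sub_zero]
    rw [if_pos hq, one_mul, coeff_coe_chartTransform q x y hxy hσ F hF, h1, h2, Nat.sub_add_cancel hmx,
      MvPolynomial.coeff_coe]
  · rw [if_neg hq]
    have hmx : m x < q := by
      by_contra hge
      push Not at hge
      apply hq
      intro l
      rw [Finsupp.single_apply]
      split_ifs with hl
      · subst hl; exact hge
      · exact Nat.zero_le _
    split_ifs with hle
    · rw [MvPolynomial.coeff_coe]
      symm
      by_contra hne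
      have hmem : Finsupp.single x (m x - m y) + Finsupp.single y (m y) ∈ F.support :=
        MvPolynomial.mem_support_iff.mpr hne
      have := hF _ hmem
      rw [hdeg, ssa_l hxy, ssa_r hxy] at this
      omega
    · rfl

/-- **The atlas step at the origin of the `x`-chart as a series identity**: `x^q · ↑(step q x 0 s).F =
(clean_q ↑s.F)(x, xy)` — translation by `0`, chart transform, deletion of `q`-th powers (all monomials of `s.F` of
degree `≥ q`). [cite: HauserPerlega2024, §2 p. 774 l. 4–20 (localized blowup, t = 0, clean again)] -/
theorem X_pow_mul_coe_step_zero [DecidableEq K] (q : ℕ) (x y : σ) (hxy : x ≠ y) (hσ : ∀ l, l = x ∨ l = y)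
    (s : State σ K) (hF : ∀ d ∈ s.F.support, q ≤ d.degree) :
    (MvPowerSeries.X x : MvPowerSeries σ K) ^ q * ((step q x 0 s).F : MvPowerSeries σ K) =
      MvPowerSeries.subst (fun l => if l = y then (MvPowerSeries.X x : MvPowerSeries σ K) * MvPowerSeries.X y
        else MvPowerSeries.X l) (cleanSeries q (s.F : MvPowerSeries σ K)) := by
  have hstep : (step q x 0 s).F = deletePthPowers q (chartTransform q x s.F) := by
    show deletePthPowers q (translate 0 (chartTransform q x s.F)) = _
    rw [translate_zero]
  rw [hstep, coe_deletePthPowers, ← cleanSeries_X_pow_mul' q x y hxy hσ, X_pow_mul_coe_chartTransform q x y hxy hσ s.F hF,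
    cleanSeries_subst_step q x y hxy hσ]

end Bridges

/-! ## C. Typed case (iii): the tangent flags `⟨y, x, h⟩` at `a′` and `⟨y, x, X·h⟩` at `a` -/

section Typed

variable {σ : Type*} [Fintype σ] [DecidableEq σ] {K : Type*} [Field K] [DecidableEq K]

/-- the cleaned expansions along `⟨y,x,h⟩` at `a′` and `⟨y,x,X·h⟩` at `a` are related by the monomial step.
[cite: HauserPerlega2024, Prop. 4 proof case (iii) p. 795 l. 22–26 (F′₁(x,y) = x^{−pᵉ}F₀(x,xy))] -/
theorem X_pow_mul_expansion_step (p : ℕ) [Fact p.Prime] [CharP K p] {e : ℕ} (x y : σ) (hxy : x ≠ y)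
    (hσ : ∀ l, l = x ∨ l = y) (s : State σ K) (hF : ∀ d ∈ s.F.support, p ^ e ≤ d.degree) (h : PowerSeries K)
    (hh : PowerSeries.constantCoeff h = 0) :
    (MvPowerSeries.X x : MvPowerSeries σ K) ^ p ^ e *
        (⟨y, x, h⟩ : FlagDatum σ K).expansion (p ^ e) (step (p ^ e) x 0 s).F =
      MvPowerSeries.subst (fun l => if l = y then (MvPowerSeries.X x : MvPowerSeries σ K) * MvPowerSeries.X y
        else MvPowerSeries.X l) ((⟨y, x, PowerSeries.X * h⟩ : FlagDatum σ K).expansion (p ^ e) s.F) := by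
  have hnegh : PowerSeries.constantCoeff (-h) = 0 := by rw [map_neg, hh, neg_zero]
  show (MvPowerSeries.X x : MvPowerSeries σ K) ^ p ^ e * cleanSeries (p ^ e) (substFree x y (-h) (step (p ^ e) x 0 s).F) =
    MvPowerSeries.subst (fun l => if l = y then (MvPowerSeries.X x : MvPowerSeries σ K) * MvPowerSeries.X y
        else MvPowerSeries.X l) (cleanSeries (p ^ e) (substFree x y (-(PowerSeries.X * h)) s.F))
  rw [substFree_eq_subst, substFree_eq_subst, ← mul_neg,
    X_pow_mul_cleanShift_eq_step_of_clean p x y hxy hσ (s.F : MvPowerSeries σ K) _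
      (X_pow_mul_coe_step_zero (p ^ e) x y hxy hσ s hF) (-h) hnegh]

/-- **"`d^curv_𝓖 = d^curv_𝓕`"** (typed): along the monomial point step `step q x 0 s` (`q = pᵉ ≤ ord s.F`),
`dCurv q ⟨y,x,h⟩ n F′ = dCurv q ⟨y,x,X·h⟩ (n+1) s.F`. [cite: HauserPerlega2024, Prop. 4 proof case (iii) p. 795 l. 27–30] -/
theorem dCurv_step_eq (p : ℕ) [Fact p.Prime] [CharP K p] {e : ℕ} (x y : σ) (hxy : x ≠ y) (hσ : ∀ l, l = x ∨ l = y)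
    (s : State σ K) (hF : ∀ d ∈ s.F.support, p ^ e ≤ d.degree) (h : PowerSeries K)
    (hh : PowerSeries.constantCoeff h = 0) (n : ℕ) :
    dCurv (p ^ e) ⟨y, x, h⟩ n (step (p ^ e) x 0 s).F = dCurv (p ^ e) ⟨y, x, PowerSeries.X * h⟩ (n + 1) s.F := by
  have hT := X_pow_mul_expansion_step p x y hxy hσ s hF h hh
  have hwx : (⟨y, x, PowerSeries.X * h⟩ : FlagDatum σ K).weights (n + 1) x = (⟨y, x, h⟩ : FlagDatum σ K).weights n x := by
    unfold FlagDatum.weights; rw [if_neg hxy, if_neg hxy]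
  have hwy : (⟨y, x, PowerSeries.X * h⟩ : FlagDatum σ K).weights (n + 1) y =
      (⟨y, x, h⟩ : FlagDatum σ K).weights n y + (⟨y, x, h⟩ : FlagDatum σ K).weights n x := by
    unfold FlagDatum.weights; rw [if_pos rfl, if_pos rfl, if_neg hxy]
  exact (ordAlong_initialPart_eq_of_step (p ^ e) x y hxy hσ _ _ hT _ _ hwx hwy).symm

/-- **"Hence `d_𝓖 = d_𝓕`"** (typed): `dFlag q ⟨y,x,h⟩ n F′ = dFlag q ⟨y,x,X·h⟩ (n+1) s.F` along `step q x 0 s`.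
[cite: HauserPerlega2024, Prop. 4 proof case (iii) p. 795 l. 29–30] -/
theorem dFlag_step_eq (p : ℕ) [Fact p.Prime] [CharP K p] {e : ℕ} (x y : σ) (hxy : x ≠ y) (hσ : ∀ l, l = x ∨ l = y)
    (s : State σ K) (hF : ∀ d ∈ s.F.support, p ^ e ≤ d.degree) (h : PowerSeries K)
    (hh : PowerSeries.constantCoeff h = 0) (n : ℕ) :
    dFlag (p ^ e) ⟨y, x, h⟩ n (step (p ^ e) x 0 s).F = dFlag (p ^ e) ⟨y, x, PowerSeries.X * h⟩ (n + 1) s.F := by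
  have hT := X_pow_mul_expansion_step p x y hxy hσ s hF h hh
  have hwx : (⟨y, x, PowerSeries.X * h⟩ : FlagDatum σ K).weights (n + 1) x = (⟨y, x, h⟩ : FlagDatum σ K).weights n x := by
    unfold FlagDatum.weights; rw [if_neg hxy, if_neg hxy]
  have hwy : (⟨y, x, PowerSeries.X * h⟩ : FlagDatum σ K).weights (n + 1) y =
      (⟨y, x, h⟩ : FlagDatum σ K).weights n y + (⟨y, x, h⟩ : FlagDatum σ K).weights n x := by
    unfold FlagDatum.weights; rw [if_pos rfl, if_pos rfl, if_neg hxy]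
  exact dFlagShape_eq_of_step (p ^ e) x y hxy hσ _ _ hT _ _ hwx hwy

/-- **[HP24, Prop. 4 case (iii)] (typed): `inv^𝓖 < inv^𝓕`** — along the monomial point step `step q x 0 s` the tangent
flag `⟨y, x, h⟩` with multiplicity `n` at `a′` and the tangent flag `⟨y, x, X·h⟩` with multiplicity `n + 1` at `a` have the
same `d`, so `(d_𝓖, n_𝓖, 0) < (d_𝓕, n_𝓕, 0)`: "`d_𝓖 = d_𝓕`. Since `n_𝓖 < n_𝓕`, this proves `inv^𝓖_{a′}(X′) < inv^𝓕_a(X)`".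
[cite: HauserPerlega2024, Prop. 4 proof case (iii) p. 795 l. 20–31] -/
theorem invCaseTangent_step_lt (p : ℕ) [Fact p.Prime] [CharP K p] {e : ℕ} (x y : σ) (hxy : x ≠ y)
    (hσ : ∀ l, l = x ∨ l = y) (s : State σ K) (hF : ∀ d ∈ s.F.support, p ^ e ≤ d.degree) (h : PowerSeries K)
    (hh : PowerSeries.constantCoeff h = 0) (n : ℕ) :
    invCaseTangent (p ^ e) ⟨y, x, h⟩ n (step (p ^ e) x 0 s).F <
      invCaseTangent (p ^ e) ⟨y, x, PowerSeries.X * h⟩ (n + 1) s.F := by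
  unfold invCaseTangent
  rw [dFlag_step_eq p x y hxy hσ s hF h hh n, Prod.Lex.toLex_lt_toLex]
  right
  refine ⟨rfl, ?_⟩
  rw [Prod.Lex.toLex_lt_toLex]
  left
  exact Nat.lt_succ_self n

omit [Fintype σ] [DecidableEq σ] [DecidableEq K] in
/-- **"`n_𝓕 = ord h + 1 = n_𝓖 + 1`"**: if `⟨y, x, h⟩` is a tangent flag of multiplicity `n` at `a′` (w.r.t. `E′`) and
`V(y) ⊆ E_a`, then `⟨y, x, X·h⟩` is a tangent flag of multiplicity `n + 1` at `a` (w.r.t. `E`).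
[cite: HauserPerlega2024, Prop. 4 proof case (iii) p. 795 l. 20–27] -/
theorem isCaseTangent_mul_X {x y : σ} {E E' : Finset σ} (hyE : y ∈ E) {h : PowerSeries K} {n : ℕ}
    (hG : (⟨y, x, h⟩ : FlagDatum σ K).IsCaseTangent E' n) :
    (⟨y, x, PowerSeries.X * h⟩ : FlagDatum σ K).IsCaseTangent E (n + 1) := by
  have hn : 0 < n := hG.pos
  obtain ⟨⟨hyx, -⟩, -, hord, -⟩ := hG
  refine ⟨⟨hyx, ?_⟩, hyE, ?_, Or.inl (by omega)⟩
  · show PowerSeries.constantCoeff (PowerSeries.X * h) = 0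
    rw [map_mul, PowerSeries.constantCoeff_X, zero_mul]
  · show (PowerSeries.X * h).order = ((n + 1 : ℕ) : ℕ∞)
    rw [PowerSeries.order_mul, PowerSeries.order_X, show (h.order : ℕ∞) = n from hord, Nat.cast_add, Nat.cast_one,
      add_comm]

end Typed

end HauserPerlega2024

end Literature.AlgebraicGeometry.Resolution
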